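import Summits.ResolutionOfSingularities.ResolutionOfSingularities.Theorems.HilbertSamuelEliminationSigmaMaxModificationsCorridor3WLadderIsoTailsHSArcNormallyFlat
import Literature.RingTheory.HilbertSamuel.NormalFlatnessCriterion
import Mathlib.RingTheory.Ideal.MinimalPrime.Localization
import Mathlib.RingTheory.Filtration
import HarnessLib

/-!
# [OURS · L1 W4.2] D14 ROUTE G v2 — object G2e: the side input `hI` («every minimal prime lies in the arc prime») FOLLOWS from
# Bennett's equality / normal flatness along the arc (res-L1-w42-lead-1's ROUTE-G-ARCLIMIT (L5); RULING v3.14-20 (FO) «G2e := 001»)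

Cell res-hironaka, rung L, slot W4.2 (crux `SigmaMaxModifications`, stmt-ResolutionOfSingularities-19249), kernel K1, ROUTE G v2 «ARC LIMIT».
res-type-001's ROUTE-G end `not_isIsolatedInHSMaxLocus_closedPoint_of_hilbertSamuelFun_eq` (p528484) takes, besides Bennett's equality
`H^{(r)}[A_P] = H^{(0)}[A]`, the bookkeeping hypothesis `hI : ∀ 𝔮 ∈ minimalPrimes A, 𝔮 ≤ P` (CJS Lemma 2.30 (2): `I(x) = I(y)`). This file
PROVES that `hI` is automatic: Bennett's equality with `A/P` regular is normal flatness along `P` (tree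
`isNormallyFlat_of_hilbertFun_eq_hilbertSamuelFun`, HIO Thm. (22.24)); normal flatness makes every `x ∉ P` a non-zero-divisor modulo every
`P^n` (the graded pieces `P^i/P^{i+1}` are free over the domain `A/P`), hence — Krull's intersection theorem — a non-zero-divisor of `A`;
and a minimal prime consists of zero-divisors (Mathlib `Ideal.disjoint_nonZeroDivisors_of_mem_minimalPrimes`), so it cannot contain an
element outside `P`.

* `mem_pow_of_mul_mem_pow_of_isNormallyFlat`, `eq_zero_of_mul_eq_zero_of_isNormallyFlat` — `x ∉ P`, `A` normally flat along `P`: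
  `x c ∈ P^n ⇒ c ∈ P^n`, `x c = 0 ⇒ c = 0`.
* **`minimalPrimes_le_of_isNormallyFlat`**, **`minimalPrimes_le_of_hilbertSamuelFun_eq`** — `hI`.
* `not_isIsolatedInHSMaxLocus_closedPoint_of_hilbertSamuelFun_eq'`, `…_of_isNormallyFlat'` — res-type-001's ROUTE-G ends WITHOUT the
  `hI` hypothesis (the forms G2f / H∞-FINAL-G consume).

[OURS · L1 W4.2] AI-written (res-type-001 g8); AI review is weaker than expert review. NOT a statement of any source nor of H. Hironaka's
2017 manuscript.
-/

set_option linter.dupNamespace false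

noncomputable section

open CategoryTheory AlgebraicGeometry TopologicalSpace IsLocalRing
open Literature.AlgebraicGeometry.Resolution Literature.RingTheory.HilbertSamuel
open Literature.AlgebraicGeometry.CossartJannsenSaito2020

namespace Summit.ResolutionOfSingularities.ResolutionOfSingularities.Theorems.SigmaMaxModificationsCorridor3.IsoTailsHS

universe u

section Regular

variable {A : Type u} [CommRing A] [IsLocalRing A] [IsNoetherianRing A]

/-- **Normal flatness makes `x ∉ P` regular modulo every power of `P`**: if every `P^i/P^{i+1}` is flat (hence free) over the
domain `A/P`, then `x c ∈ P^n ⇒ c ∈ P^n` (induction on `n` through the torsion-free graded pieces; the argument of the tree's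
`NormalFlatnessCriterion`, transitivity step). [cite: HerrmannIkedaOrbanz1988, Thm. (22.24)] -/
theorem mem_pow_of_mul_mem_pow_of_isNormallyFlat (P : Ideal A) [P.IsPrime] (hNF : P.IsNormallyFlat) {x : A} (hxP : x ∉ P)
    (n : ℕ) {c : A} (h : x * c ∈ P ^ n) : c ∈ P ^ n := by
  have hx0 : Ideal.Quotient.mk P x ≠ 0 := fun h0 => hxP (Ideal.Quotient.eq_zero_iff_mem.mp h0)
  have hxreg : IsRegular (Ideal.Quotient.mk P x) := IsRegular.of_ne_zero' hx0
  have hfree : ∀ i, Module.Free (A ⧸ P) (gradedPiece P i) := fun i => by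
    haveI := hNF i
    haveI : Module.Finite (A ⧸ P) (gradedPiece P i) := Module.Finite.of_restrictScalars_finite A _ _
    exact Module.free_of_flat_of_isLocalRing
  have key : ∀ i ≤ n, c ∈ P ^ i := by
    intro i
    induction i with
    | zero => intro; simp
    | succ i ih =>
      intro hi
      have hci : c ∈ P ^ i := ih (Nat.le_of_succ_le hi)
      haveI := hfree i
      have hsm : IsSMulRegular (gradedPiece P i) (Ideal.Quotient.mk P x) :=
        Module.IsTorsionFree.isSMulRegular hxreg
      have h0 : (Ideal.Quotient.mk P x) • gradedPiece.mk P i ⟨c, hci⟩ = 0 := by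
        change x • gradedPiece.mk P i ⟨c, hci⟩ = 0
        rw [← map_smul, gradedPiece.mk_eq_zero_iff]
        exact Ideal.pow_le_pow_right hi h
      have h1 : gradedPiece.mk P i ⟨c, hci⟩ = 0 :=
        hsm (show (Ideal.Quotient.mk P x) • gradedPiece.mk P i ⟨c, hci⟩ =
          (Ideal.Quotient.mk P x) • (0 : gradedPiece P i) by rw [h0, smul_zero])
      rw [gradedPiece.mk_eq_zero_iff] at h1
      exact h1
  exact key n le_rfl

/-- Hence `x ∉ P` is a NON-ZERO-DIVISOR of `A` when `A` is normally flat along `P` (Krull's intersection theorem `⋂ P^n = 0` in the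
Noetherian local ring `A`). [cite: HerrmannIkedaOrbanz1988, Thm. (22.24)] [cite: Matsumura1987, Thm. 8.10] -/
theorem eq_zero_of_mul_eq_zero_of_isNormallyFlat (P : Ideal A) [P.IsPrime] (hNF : P.IsNormallyFlat) {x : A} (hxP : x ∉ P) {c : A}
    (h : x * c = 0) : c = 0 := by
  have hmem : c ∈ ⨅ n : ℕ, P ^ n :=
    Ideal.mem_iInf.mpr fun n => mem_pow_of_mul_mem_pow_of_isNormallyFlat P hNF hxP n (by rw [h]; exact zero_mem _)
  rwa [Ideal.iInf_pow_eq_bot_of_isLocalRing P (Ideal.IsPrime.ne_top inferInstance), Ideal.mem_bot] at hmem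

/-- **`hI` from normal flatness: every minimal prime of `A` lies in `P`** when `A` is normally flat along the prime `P` — a minimal
prime consists of zero-divisors (Mathlib `Ideal.disjoint_nonZeroDivisors_of_mem_minimalPrimes`), and no zero-divisor lies outside `P`.
(res-L1-w42-lead-1's ROUTE-G-ARCLIMIT (L5).) [OURS · L1 W4.2; AI-written] [cite: CossartJannsenSaito2020, Lemma 2.30 (2), Thm. 3.3] -/
theorem minimalPrimes_le_of_isNormallyFlat (P : Ideal A) [P.IsPrime] (hNF : P.IsNormallyFlat) :
    ∀ 𝔮 ∈ minimalPrimes A, 𝔮 ≤ P := by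
  intro 𝔮 h𝔮 s hs
  by_contra hsP
  have hzd : s ∉ nonZeroDivisors A := notMem_nonZeroDivisors_of_mem_mem_minimalPrimes hs h𝔮
  apply hzd
  rw [mem_nonZeroDivisors_iff_right]
  intro c hc
  exact eq_zero_of_mul_eq_zero_of_isNormallyFlat P hNF hsP (by rw [mul_comm]; exact hc)

/-- **`hI` from Bennett's equality**: for `A/P` regular of dimension `r` and `H^{(r)}[A_P] = H^{(0)}[A]` (so `A` is normally flat along
`P`, tree `isNormallyFlat_of_hilbertFun_eq_hilbertSamuelFun`, HIO Thm. (22.24)), every minimal prime of `A` lies in `P`.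
[OURS · L1 W4.2; AI-written] [cite: HerrmannIkedaOrbanz1988, Thm. (22.24)] [cite: CossartJannsenSaito2020, Thm. 3.3] -/
theorem minimalPrimes_le_of_hilbertSamuelFun_eq (P : Ideal A) [P.IsPrime] [IsRegularLocalRing (A ⧸ P)] {r : ℕ}
    (hr : ringKrullDim (A ⧸ P) = (r : ℕ)) (hH : hilbertSamuelFun (Localization.AtPrime P) r = hilbertFun A) :
    ∀ 𝔮 ∈ minimalPrimes A, 𝔮 ≤ P :=
  minimalPrimes_le_of_isNormallyFlat P
    (isNormallyFlat_of_hilbertFun_eq_hilbertSamuelFun P (Localization.AtPrime P) r hr hH.symm)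

end Regular

/-! ## The ROUTE-G ends without the `hI` hypothesis -/

/-- **ROUTE-G END, `hI`-free**: `A` catenary Noetherian local, `P ≠ 𝔪` prime with `A/P` regular of dimension `r`, Bennett's
equality `H^{(r)}[A_P] = H^{(0)}[A]`, `N ≥ ψ(A)` ⟹ the closed point of `Spec A` is NOT isolated in the Hilbert–Samuel locus
(`not_isIsolatedInHSMaxLocus_closedPoint_of_hilbertSamuelFun_eq` + `minimalPrimes_le_of_hilbertSamuelFun_eq`). [OURS · L1 W4.2; AI-written]
[cite: CossartJannsenSaito2020, Def. 2.35, Thm. 3.3] -/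
theorem not_isIsolatedInHSMaxLocus_closedPoint_of_hilbertSamuelFun_eq' {A : Type u} [CommRing A] [IsNoetherianRing A]
    [IsLocalRing A] (hA : IsCatenaryRing A) (P : Ideal A) [P.IsPrime] [IsRegularLocalRing (A ⧸ P)] (hPm : P ≠ maximalIdeal A)
    {r : ℕ} (hr : ringKrullDim (A ⧸ P) = (r : ℕ)) (hH : hilbertSamuelFun (Localization.AtPrime P) r = hilbertFun A) {N : ℕ}
    (hN : minimalPrimesCodim A ≤ N) :
    ¬ IsIsolatedInHSMaxLocus (Spec (CommRingCat.of A)) N (closedPoint A) :=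
  not_isIsolatedInHSMaxLocus_closedPoint_of_hilbertSamuelFun_eq hA P hPm hr (minimalPrimes_le_of_hilbertSamuelFun_eq P hr hH) hH hN

/-- **ROUTE-G END from normal flatness, `hI`-free**: `A` catenary Noetherian local, `P` prime with `A/P` regular of dimension `r ≥ 1`,
`A` normally flat along `P`, `N ≥ ψ(A)` ⟹ the closed point of `Spec A` is NOT isolated in the Hilbert–Samuel locus.
[OURS · L1 W4.2; AI-written] [cite: CossartJannsenSaito2020, Def. 3.1, Thm. 3.3] -/
theorem not_isIsolatedInHSMaxLocus_closedPoint_of_isNormallyFlat' {A : Type u} [CommRing A] [IsNoetherianRing A]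
    [IsLocalRing A] (hA : IsCatenaryRing A) (P : Ideal A) [P.IsPrime] [IsRegularLocalRing (A ⧸ P)] {r : ℕ} (hr1 : 1 ≤ r)
    (hr : ringKrullDim (A ⧸ P) = (r : ℕ)) (hNF : P.IsNormallyFlat) {N : ℕ} (hN : minimalPrimesCodim A ≤ N) :
    ¬ IsIsolatedInHSMaxLocus (Spec (CommRingCat.of A)) N (closedPoint A) :=
  not_isIsolatedInHSMaxLocus_closedPoint_of_isNormallyFlat hA P hr1 hr (minimalPrimes_le_of_isNormallyFlat P hNF) hNF hN

end Summit.ResolutionOfSingularities.ResolutionOfSingularities.Theorems.SigmaMaxModificationsCorridor3.IsoTailsHS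

end
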